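import Summits.CriticalPhenomena.PercolationContinuityZ3.Theorems.PercNearOneGluingNoHeavyLowerTailSahiC3CubeFourFKGScan
import Summits.CriticalPhenomena.PercolationContinuityZ3.Theorems.PercNearOneGluingNoHeavyLowerTailSahiC3CubeFourFKGPermCode
import Summits.CriticalPhenomena.PercolationContinuityZ3.Theorems.PercNearOneGluingNoHeavyLowerTailSahiC3CubeFourFKGHard0
import Summits.CriticalPhenomena.PercolationContinuityZ3.Theorems.PercNearOneGluingNoHeavyLowerTailSahiC3CubeFourFKGHard1
import Summits.CriticalPhenomena.PercolationContinuityZ3.Theorems.PercNearOneGluingNoHeavyLowerTailSahiC3CubeFourFKGHard2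
import Summits.CriticalPhenomena.PercolationContinuityZ3.Theorems.PercNearOneGluingNoHeavyLowerTailSahiC3CubeFourFKGHard3
import Summits.CriticalPhenomena.PercolationContinuityZ3.Theorems.PercNearOneGluingNoHeavyLowerTailSahiC3CubeFourFKGHard4
import Summits.CriticalPhenomena.PercolationContinuityZ3.Theorems.PercNearOneGluingNoHeavyLowerTailSahiC3CubeFourFKGHard6
import Summits.CriticalPhenomena.PercolationContinuityZ3.Theorems.PercNearOneGluingNoHeavyLowerTailSahiC3CubeFourFKGHard7
import Summits.CriticalPhenomena.PercolationContinuityZ3.Theorems.PercNearOneGluingNoHeavyLowerTailSahiC3CubeFourFKGHard8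
import Summits.CriticalPhenomena.PercolationContinuityZ3.Theorems.PercNearOneGluingNoHeavyLowerTailSahiC3CubeFourFKGHard9
import Summits.CriticalPhenomena.PercolationContinuityZ3.Theorems.PercNearOneGluingNoHeavyLowerTailSahiC3CubeFourFKGHard10
import Summits.CriticalPhenomena.PercolationContinuityZ3.Theorems.PercNearOneGluingNoHeavyLowerTailSahiC3CubeFourFKGOrbit5D
import Summits.CriticalPhenomena.PercolationContinuityZ3.Theorems.PercNearOneGluingNoHeavyLowerTailSahiC3CubeFunctions
import Mathlib.Tactic.IntervalCases
import HarnessLib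
import HarnessLib.Audit

/-!
# `NoHeavyLowerTail` (crux stmt-CriticalPhenomena-4575), Sahi programme P4: **Sahi's `C₃` on `{0,1}⁴` for EVERY FKG weight** —
# `SahiConjecture 3` holds on the Boolean lattice `2⁴` (standard axioms)

Support file (cell `prim-l12`, seat P4; `--supports stmt-CriticalPhenomena-4575`).  No named facts, no sorries; axioms `propext`,
`Classical.choice`, `Quot.sound` only (the whole chain — orbit certificates, tri-saturation, code bridges, kernel scan — is `decide`/`decide +kernel`
and `ring`; no `native_decide`).

**Theorem `sahiC3_cube_four_fkg`.**  For every nonnegative log-supermodular weight `μ` on `Fin 4 → Bool` and all up-sets `U, A, B`: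
`0 ≤ latticeE3 μ U A B = 2Z²·μ(U∩A∩B) + μ(U)μ(A)μ(B) − Z·(μ(U)μ(A∩B) + μ(A)μ(U∩B) + μ(B)μ(U∩A))` (`Z = μ(univ)`), i.e. Sahi's third
inequality `E₃(1_U,1_A,1_B) ≥ 0` [Sahi, Combinatorica 28 (2008), Conj. 5; Lieb–Sahi, J. Math. Phys. 63 (2022), Conj. 1.1, `n = 3`; for product
measures Kahn, arXiv:2208.07271, Conj. 5].  Corollaries: the three-function form `latticeE3fun_nonneg_cube_four` (all monotone nonnegative
`f, g, h`, by trilinearity `SahiC3Cube.latticeE3fun_nonneg_of_indicator`) and, in the Literature's vocabulary,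
**`sahiPositive_three_cube_four : IsFKGMeasure μ → SahiPositive μ 3`** for every FKG probability weight on `Fin 4 → Bool` — the obligation
`SahiConjecture 3` of `Theorems/SahiConjecture.lean` restricted to the lattice `2⁴` (previously in the tree: `2³` for all FKG weights,
`…SahiC3CubeThreeFKG`; `2⁴` for PRODUCT weights only and computational, `…SahiC3CubeFour`).

PROOF (assembly of landed pieces, HOME prim-l12-p4/ASSEMBLY-PLAN-FKG-CUBE4.md).  (1) `C3Transport.forall_latticeE3_nonneg_of_triSaturated`:
it suffices to treat TRI-SATURATED triples.  (2) `…SahiC3CubeFourFKGCodes.bisatB_of_sat` + `encF_mem_ups4`: their codes are up-set codes,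
tri-saturated on codes; after sorting the three codes (`latticeE3_comm₁₂/₂₃/₁₃`) the kernel scan `…Scan.reasonB_of_trisatB` yields a reason.
(3) Each reason is a tree theorem: empty slot (`latticeE3_empty`), full slot (`latticeE3_univ_nonneg`, FKG), junta meet
(`SahiC3CubeFourFKG.latticeE3_nonneg_of_indepCoord`, the cube locality corollary of `…SahiE3DeterminedMeetFKGCube` over `C₃` on `2³`), residual
(`orbit_nonneg` = the eleven orbit theorems `SahiC3CubeFourFKG.orbit{k}_nonneg` (exact Ahlswede–Daykin/point-minor certificates) and
`orbit5_nonneg_of_nonneg` (layer cake + positive density), transported along the coordinate relabelling by `…PermCode.latticeE3_nonneg_of_perm`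
and across slot arrangements by `nonneg_of_arr`).
-/

namespace Summit.CriticalPhenomena.PercolationContinuityZ3.Theorems.SahiC3CubeFourFKG

open Finset Literature.Probability.LatticeModels Literature.Combinatorics.Sahi2008 SahiC3Cube OneCutCert C3Transport

/-! ### Discharging the reasons -/

variable {μ : (Fin 4 → Bool) → ℝ}

/-- The eleven residual-orbit theorems, indexed by `rep`. [this work] -/
theorem orbit_nonneg (hμ₀ : 0 ≤ μ) (hμ : ∀ a b, μ a * μ b ≤ μ (a ⊓ b) * μ (a ⊔ b)) {k : ℕ} (hk : k < 11)
    {U A B : Finset (Fin 4 → Bool)} (hU : encF 4 U = (rep k).1) (hA : encF 4 A = (rep k).2.1) (hB : encF 4 B = (rep k).2.2) :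
    0 ≤ latticeE3 μ U A B := by
  interval_cases k
  · exact orbit0_nonneg hμ₀ hμ hU hA hB
  · exact orbit1_nonneg hμ₀ hμ hU hA hB
  · exact orbit2_nonneg hμ₀ hμ hU hA hB
  · exact orbit3_nonneg hμ₀ hμ hU hA hB
  · exact orbit4_nonneg hμ₀ hμ hU hA hB
  · exact orbit5_nonneg_of_nonneg hμ₀ hμ hU hA hB
  · exact orbit6_nonneg hμ₀ hμ hU hA hB
  · exact orbit7_nonneg hμ₀ hμ hU hA hB
  · exact orbit8_nonneg hμ₀ hμ hU hA hB
  · exact orbit9_nonneg hμ₀ hμ hU hA hB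
  · exact orbit10_nonneg hμ₀ hμ hU hA hB

/-- A statement for the codes `r` in slot order transfers to each of the six slot arrangements `arr r s`. [folklore] -/
theorem nonneg_of_arr {r : ℕ × ℕ × ℕ}
    (h : ∀ U A B : Finset (Fin 4 → Bool), encF 4 U = r.1 → encF 4 A = r.2.1 → encF 4 B = r.2.2 → 0 ≤ latticeE3 μ U A B)
    {s : ℕ} (hs : s < 6) {U A B : Finset (Fin 4 → Bool)} (hU : encF 4 U = (arr r s).1) (hA : encF 4 A = (arr r s).2.1)
    (hB : encF 4 B = (arr r s).2.2) : 0 ≤ latticeE3 μ U A B := by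
  obtain ⟨r0, r1, r2⟩ := r
  interval_cases s
  · exact h U A B hU hA hB
  · rw [latticeE3_comm₂₃]; exact h U B A hU hB hA
  · rw [latticeE3_comm₁₂]; exact h A U B hA hU hB
  · rw [latticeE3_comm₁₃, latticeE3_comm₂₃]; exact h B U A hB hU hA
  · rw [latticeE3_comm₁₂, latticeE3_comm₂₃]; exact h A B U hA hB hU
  · rw [latticeE3_comm₁₃]; exact h B A U hB hA hU

/-- The representative codes and their arrangements are `16`-bit. [this work] -/
theorem arr_rep_lt : ∀ k < 11, ∀ s < 6,
    (arr (rep k) s).1 < 2 ^ 2 ^ 4 ∧ (arr (rep k) s).2.1 < 2 ^ 2 ^ 4 ∧ (arr (rep k) s).2.2 < 2 ^ 2 ^ 4 := by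
  decide

/-- **Residual reason**: a certifying table entry gives `0 ≤ latticeE3 μ U A B` (coordinate relabelling `SahiC3CubeFourFKG.latticeE3_nonneg_of_perm`
of the orbit theorem, then slot symmetry). [this work] -/
theorem nonneg_of_entryB (hμ₀ : 0 ≤ μ) (hμ : ∀ a b, μ a * μ b ≤ μ (a ⊓ b) * μ (a ⊔ b)) {U A B : Finset (Fin 4 → Bool)}
    {e : ℕ × ℕ × ℕ × ℕ × ℕ × List ℕ × List ℕ} (he : entryB (encF 4 U) (encF 4 A) (encF 4 B) e = true) :
    0 ≤ latticeE3 μ U A B := by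
  obtain ⟨u', a', b', k, s, pl, ql⟩ := e
  unfold entryB at he
  simp only [Bool.and_eq_true, beq_iff_eq, decide_eq_true_eq] at he
  obtain ⟨⟨⟨⟨⟨⟨⟨⟨-, -⟩, -⟩, hk⟩, hs⟩, hinv⟩, hrU⟩, hrA⟩, hrB⟩ := he
  unfold permInvB at hinv
  rw [List.all_eq_true] at hinv
  have hinv' : ∀ i : Fin 4, permFun ql (permFun pl i) = i ∧ permFun pl (permFun ql i) = i := by
    intro i
    have := hinv i (List.mem_range.2 i.2)
    simp only [Bool.and_eq_true, beq_iff_eq] at this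
    exact ⟨Fin.ext this.1, Fin.ext this.2⟩
  let p : Equiv.Perm (Fin 4) := ⟨permFun pl, permFun ql, fun i => (hinv' i).1, fun i => (hinv' i).2⟩
  have hrel : ∀ {S : Finset (Fin 4 → Bool)} {r : ℕ}, relabelB (encF 4 S) pl r = true →
      ∀ j < 2 ^ 4, (encF 4 S).testBit (enc2 (ptB 4 j ∘ p)) = r.testBit j := by
    intro S r h j hj
    unfold relabelB at h
    rw [List.all_eq_true] at h
    have := h j (List.mem_range.2 (by simpa using hj))
    simp only [beq_iff_eq] at this
    exact this
  have hr := arr_rep_lt k hk s hs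
  exact latticeE3_nonneg_of_perm p hr.1 hr.2.1 hr.2.2
    (fun ν hν₀ hν U' A' B' hU' hA' hB' =>
      nonneg_of_arr (fun U A B hU hA hB => orbit_nonneg hν₀ hν hk hU hA hB) hs hU' hA' hB')
    hμ₀ hμ (hrel hrU) (hrel hrA) (hrel hrB)

/-- **Junta reason**: some pairwise meet does not depend on some coordinate (cube locality corollary, via
`SahiC3CubeFourFKG.latticeE3_nonneg_of_indepCoord`). [this work] -/
theorem nonneg_of_juntaB (hμ₀ : 0 ≤ μ) (hμ : ∀ a b, μ a * μ b ≤ μ (a ⊓ b) * μ (a ⊔ b)) {U A B : Finset (Fin 4 → Bool)}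
    (hU : IsUpperSet (U : Set (Fin 4 → Bool))) (hA : IsUpperSet (A : Set (Fin 4 → Bool))) (hB : IsUpperSet (B : Set (Fin 4 → Bool)))
    (h : juntaB (encF 4 U) (encF 4 A) (encF 4 B) = true) : 0 ≤ latticeE3 μ U A B := by
  unfold juntaB at h
  rw [List.any_eq_true] at h
  obtain ⟨i, hi, h⟩ := h
  rw [List.mem_range] at hi
  simp only [Bool.or_eq_true] at h
  rcases h with (h | h) | h
  · exact latticeE3_nonneg_of_indepCoord₁₂ hμ₀ hμ hU hA hB ⟨i, hi⟩ h
  · exact latticeE3_nonneg_of_indepCoord₁₃ hμ₀ hμ hU hA hB ⟨i, hi⟩ h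
  · exact latticeE3_nonneg_of_indepCoord hμ₀ hμ hU hA hB ⟨i, hi⟩ h

/-- **Every reason is a theorem.** [this work] -/
theorem nonneg_of_reasonB (hμ₀ : 0 ≤ μ) (hμ : ∀ a b, μ a * μ b ≤ μ (a ⊓ b) * μ (a ⊔ b)) {U A B : Finset (Fin 4 → Bool)}
    (hU : IsUpperSet (U : Set (Fin 4 → Bool))) (hA : IsUpperSet (A : Set (Fin 4 → Bool))) (hB : IsUpperSet (B : Set (Fin 4 → Bool)))
    (h : reasonB (encF 4 U) (encF 4 A) (encF 4 B) = true) : 0 ≤ latticeE3 μ U A B := by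
  unfold reasonB at h
  simp only [Bool.or_eq_true, beq_iff_eq] at h
  rcases h with ((h | h) | h) | h
  · rw [eq_empty_of_encF h, latticeE3_empty]
  · have hB' : encF 4 B = 2 ^ 2 ^ 4 - 1 := by rw [h]; norm_num
    rw [eq_univ_of_encF hB', latticeE3_comm₁₃]
    exact latticeE3_univ_nonneg hμ₀ hμ hA hU
  · exact nonneg_of_juntaB hμ₀ hμ hU hA hB h
  · unfold residualB at h
    rw [List.any_eq_true] at h
    obtain ⟨e, -, he⟩ := h
    exact nonneg_of_entryB hμ₀ hμ he

/-- The sorted case: codes `u ≤ a ≤ b`, tri-saturated on codes. [this work] -/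
theorem nonneg_sorted (hμ₀ : 0 ≤ μ) (hμ : ∀ a b, μ a * μ b ≤ μ (a ⊓ b) * μ (a ⊔ b)) {U A B : Finset (Fin 4 → Bool)}
    (hU : IsUpperSet (U : Set (Fin 4 → Bool))) (hA : IsUpperSet (A : Set (Fin 4 → Bool))) (hB : IsUpperSet (B : Set (Fin 4 → Bool)))
    (hua : encF 4 U ≤ encF 4 A) (hab : encF 4 A ≤ encF 4 B) (ht : trisatB (encF 4 U) (encF 4 A) (encF 4 B) = true) :
    0 ≤ latticeE3 μ U A B :=
  nonneg_of_reasonB hμ₀ hμ hU hA hB (reasonB_of_trisatB (encF_mem_ups4 hU) (encF_mem_ups4 hA) (encF_mem_ups4 hB) hua hab ht)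

/-- **Sahi's `C₃` for a tri-saturated triple of up-sets of `{0,1}⁴`**, every nonnegative log-supermodular weight. [this work] -/
theorem latticeE3_nonneg_of_triSaturated_four [DecidableLE (Fin 4 → Bool)] (hμ₀ : 0 ≤ μ) (hμ : ∀ a b, μ a * μ b ≤ μ (a ⊓ b) * μ (a ⊔ b))
    {U A B : Finset (Fin 4 → Bool)} (hU : IsUpperSet (U : Set (Fin 4 → Bool))) (hA : IsUpperSet (A : Set (Fin 4 → Bool)))
    (hB : IsUpperSet (B : Set (Fin 4 → Bool))) (hT : TriSaturated U A B) : 0 ≤ latticeE3 μ U A B := by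
  have bU := bisatB_of_sat hU hT.1.1 hT.1.2
  have bA := bisatB_of_sat hA hT.2.1.1 hT.2.1.2
  have bB := bisatB_of_sat hB hT.2.2.1 hT.2.2.2
  have C : ∀ {x y z : ℕ}, bisatB x (y &&& z) = true → bisatB x (z &&& y) = true := fun h => by rwa [Nat.land_comm]
  have bU' := C bU
  have bA' := C bA
  have bB' := C bB
  have T : ∀ {x y z : ℕ}, bisatB x (y &&& z) = true → bisatB y (x &&& z) = true → bisatB z (x &&& y) = true →
      trisatB x y z = true := fun h1 h2 h3 => by unfold trisatB; simp [h1, h2, h3]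
  rcases le_total (encF 4 U) (encF 4 A) with hUA | hAU
  · rcases le_total (encF 4 A) (encF 4 B) with hAB | hBA
    · exact nonneg_sorted hμ₀ hμ hU hA hB hUA hAB (T bU bA bB)
    · rcases le_total (encF 4 U) (encF 4 B) with hUB | hBU
      · rw [latticeE3_comm₂₃]
        exact nonneg_sorted hμ₀ hμ hU hB hA hUB hBA (T bU' bB bA)
      · rw [latticeE3_comm₂₃, latticeE3_comm₁₂]
        exact nonneg_sorted hμ₀ hμ hB hU hA hBU hUA (T bB bU' bA')
  · rcases le_total (encF 4 U) (encF 4 B) with hUB | hBU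
    · rw [latticeE3_comm₁₂]
      exact nonneg_sorted hμ₀ hμ hA hU hB hAU hUB (T bA bU bB')
    · rcases le_total (encF 4 A) (encF 4 B) with hAB | hBA
      · rw [latticeE3_comm₁₂, latticeE3_comm₂₃]
        exact nonneg_sorted hμ₀ hμ hA hB hU hAB hBU (T bA' bB' bU)
      · rw [latticeE3_comm₁₃]
        exact nonneg_sorted hμ₀ hμ hB hA hU hBA hAU (T bB' bA' bU')

/-! ### The theorem -/

/-- **Sahi's third inequality `C₃` on `{0,1}⁴` for every FKG weight** [Sahi 2008, Conj. 5 / Lieb–Sahi 2022, Conj. 1.1 at `n = 3`, on the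
Boolean lattice `2⁴`; Kahn 2022, Conj. 5 for all FKG measures on four coordinates]: for every nonnegative log-supermodular `μ` on
`Fin 4 → Bool` and all up-sets `U, A, B`,
`0 ≤ 2Z²·μ(U∩A∩B) + μ(U)μ(A)μ(B) − Z·(μ(U)μ(A∩B) + μ(A)μ(U∩B) + μ(B)μ(U∩A))` (`= Z³·E₃(1_U,1_A,1_B)`).  Standard axioms. [this work] -/
theorem sahiC3_cube_four_fkg (hμ₀ : 0 ≤ μ) (hμ : ∀ a b, μ a * μ b ≤ μ (a ⊓ b) * μ (a ⊔ b)) (U A B : Finset (Fin 4 → Bool))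
    (hU : IsUpperSet (U : Set (Fin 4 → Bool))) (hA : IsUpperSet (A : Set (Fin 4 → Bool))) (hB : IsUpperSet (B : Set (Fin 4 → Bool))) :
    0 ≤ latticeE3 μ U A B :=
  forall_latticeE3_nonneg_of_triSaturated hμ₀ hμ (fun _ _ _ hU hA hB hT => latticeE3_nonneg_of_triSaturated_four hμ₀ hμ hU hA hB hT)
    U A B hU hA hB

/-- **Sahi's Conjecture 5 at `n = 3` on `{0,1}⁴`, three functions**: for every nonnegative log-supermodular weight on `Fin 4 → Bool` and all
monotone nonnegative `f, g, h`, `0 ≤ latticeE3fun μ f g h` (`= Z³·E₃(f,g,h)`). [this work] -/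
theorem latticeE3fun_nonneg_cube_four (hμ₀ : 0 ≤ μ) (hμ : ∀ a b, μ a * μ b ≤ μ (a ⊓ b) * μ (a ⊔ b))
    {f g h : (Fin 4 → Bool) → ℝ} (hf : Monotone f) (hg : Monotone g) (hh : Monotone h) (hf0 : ∀ x, 0 ≤ f x) (hg0 : ∀ x, 0 ≤ g x)
    (hh0 : ∀ x, 0 ≤ h x) : 0 ≤ latticeE3fun μ f g h :=
  latticeE3fun_nonneg_of_indicator (fun U A B hU hA hB => sahiC3_cube_four_fkg hμ₀ hμ U A B hU hA hB) hf hg hh hf0 hg0 hh0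

/-- **`SahiConjecture 3` holds on the lattice `{0,1}⁴`**: every FKG probability weight on `Fin 4 → Bool` is Sahi-positive of order `3`
(`Literature.Combinatorics.Sahi2008.SahiPositive μ 3`). [this work] -/
theorem sahiPositive_three_cube_four {μ : (Fin 4 → Bool) → ℝ} (hμ : IsFKGMeasure μ) : SahiPositive μ 3 := by
  intro f hf0 hf
  have e : f = ![f 0, f 1, f 2] := by
    funext i; fin_cases i <;> rfl
  rw [e, ← SahiE3DeterminedMeetFKG.latticeE3fun_eq_sahiE_three hμ.sum_eq_one]
  exact latticeE3fun_nonneg_cube_four (fun x => hμ.nonneg x) hμ.mul_le_mul (hf 0) (hf 1) (hf 2) (hf0 0) (hf0 1) (hf0 2)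

end Summit.CriticalPhenomena.PercolationContinuityZ3.Theorems.SahiC3CubeFourFKG
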